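import Literature.Geometry.Riemannian.ExpMapLocalDiffeo
import Literature.Geometry.Riemannian.RiemannianDistance
import Literature.Geometry.Lorentzian.GeodesicConfinement
import HarnessLib

/-!
# Corner cutting: broken geodesics are not minimizing (towards Lee 2018, Prop. 10.32 (a))

Layer 3c of the proof programme for `Literature.Geometry.Riemannian.lee_expMap_injectivityDomain`
(Lee 2018, Thm. 10.34). Lee proves Prop. 10.32 (a) ("`γ_v|[0,b]` … is the unique unit-speed
minimizing curve between its endpoints") and hence the injectivity of `exp_p` on `ID(p)` through
"minimizing curves are smooth geodesics" (Thm. 6.4, first variation). The only consequence needed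
for Thm. 10.34 is that a BROKEN geodesic is never minimizing, and this file proves the local
estimate behind it directly from the smoothness of `exp` (Prop. 5.19) and `d(exp_q)_0 = id`:

* `eventually_val_mfderiv_expMap_le` — for `κ > 0`, near `u = 0` the differential of `exp_q`
  is `(1 + κ)`-bounded: `|d(exp_q)_u(η)|_g ≤ (1 + κ)|η|_{g_q}` for all `η` (continuity of the
  tangent map of `exp_q` and of the metric on `TM`, compactness of the `g_q`-unit sphere);
* `edist_expMap_smul_lt` (**corner cutting**) — for `g_q`-unit vectors `a, b ∈ T_qM` with
  `a + b ≠ 0` and all small `δ > 0`, `d(exp_q(δa), exp_q(δb)) < 2δ`: the image under `exp_q` of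
  the chord from `δa` to `δb` has length `≤ (1 + κ) δ |b - a|_{g_q} < 2δ` (strict convexity of the
  norm: `|b - a| < |a| + |b|` unless `b = -a`). For a path entering `q` along `-a` and leaving
  along `b ≠ -a` this is strictly shorter than the `2δ` spent near the corner.

No definitions, no named facts (D-0026).

## References

* J. M. Lee, *Introduction to Riemannian Manifolds*, 2nd ed. (2018), Prop. 5.19, Thm. 6.4,
  Prop. 10.32 (a). [LeeRiemannianManifolds2018]
-/

noncomputable section

open Bundle Set Filter Function Metric
open scoped Manifold ContDiff Topology ENNReal

namespace Literature.Geometry.Riemannian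

open Literature.Geometry.Lorentzian
open Literature.Geometry.Lorentzian.PseudoRiemannianMetric

variable {E : Type*} [NormedAddCommGroup E] [NormedSpace ℝ E] {H : Type*} [TopologicalSpace H]
  {I : ModelWithCorners ℝ E H} {M : Type*} [TopologicalSpace M] [ChartedSpace H M]
  [IsManifold I ∞ M] {n : ℕ∞ω} [FiniteDimensional ℝ E] [CompleteSpace E] [T2Space M]
  [BoundarylessManifold I M]
  (g : PseudoRiemannianMetric I n E (TangentSpace I : M → Type _)) [g.HasLeviCivita]
  [CovariantDerivative.ContMDiffCovariantDerivative g.leviCivita 1]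

/-! ### The `g_q`-unit sphere is compact -/

omit [CompleteSpace E] [T2Space M] [BoundarylessManifold I M] [g.HasLeviCivita]
  [CovariantDerivative.ContMDiffCovariantDerivative g.leviCivita 1] in
/-- The `g_q`-unit sphere `{η | g_q(η, η) = 1}` of a positive definite `g_q` is compact (closed,
and bounded since `c‖η‖² ≤ g_q(η,η)`, `exists_pos_mul_norm_sq_le_of_pos_def`). [folklore] -/
theorem isCompact_setOf_val_eq_one (hg : g.IsRiemannian) (q : M) :
    IsCompact {η : E | g.val q (show TangentSpace I q from η) (show TangentSpace I q from η) = 1} := by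
  set f : E →L[ℝ] E →L[ℝ] ℝ := g.val q with hf
  obtain ⟨c, hc, hcv⟩ := exists_pos_mul_norm_sq_le_of_pos_def f (fun v hv ↦ hg q v hv)
  have hcont : Continuous fun η : E ↦ f η η := f.continuous₂.comp (continuous_id.prodMk continuous_id)
  refine Metric.isCompact_of_isClosed_isBounded (isClosed_eq hcont continuous_const) ?_
  refine (Metric.isBounded_closedBall (x := (0 : E)) (r := Real.sqrt c⁻¹)).subset fun η hη ↦ ?_
  have h1 : c * ‖η‖ ^ 2 ≤ 1 := (hcv η).trans_eq hη
  have h2 : ‖η‖ ^ 2 ≤ c⁻¹ := by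
    have h3 : ‖η‖ ^ 2 = c⁻¹ * (c * ‖η‖ ^ 2) := by field_simp
    rw [h3]
    calc c⁻¹ * (c * ‖η‖ ^ 2) ≤ c⁻¹ * 1 := by gcongr
      _ = c⁻¹ := mul_one _
  rw [mem_closedBall, dist_zero_right, Real.le_sqrt (norm_nonneg _) (inv_nonneg.2 hc.le)]
  exact h2

/-! ### The differential of `exp_q` is almost an isometry near `0` -/

/-- **Near `0` the differential of `exp_q` is `(1 + κ)`-bounded**: for `κ > 0` and all `u`
near `0` in `T_qM = E`, `g_{exp_q u}(d(exp_q)_u η, d(exp_q)_u η) ≤ (1 + κ)² g_q(η, η)` for every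
`η` — the quadratic form of `g` on `TM` is continuous (`continuous_val_tangentBundle`), the
tangent map of the smooth `exp_q` (Prop. 5.19 (a)) is continuous, `d(exp_q)_0 = id`
(Prop. 5.19 (d)), and the `g_q`-unit sphere is compact; homogeneity extends the estimate from unit
vectors to all `η`. [cite: LeeRiemannianManifolds2018, Prop. 5.19 (a),(d)] -/
theorem eventually_val_mfderiv_expMap_le (hn : (∞ : ℕ∞ω) ≤ n) (hg : g.IsRiemannian) (q : M)
    {κ : ℝ} (hκ : 0 < κ) :
    ∀ᶠ u : E in 𝓝 0, ∀ η : E,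
      g.val (expMap g.leviCivita q (show TangentSpace I q from u))
        (mfderiv 𝓘(ℝ, E) I (fun u : E ↦ expMap g.leviCivita q (show TangentSpace I q from u)) u η)
        (mfderiv 𝓘(ℝ, E) I (fun u : E ↦ expMap g.leviCivita q (show TangentSpace I q from u)) u η)
        ≤ (1 + κ) ^ 2 * g.val q (show TangentSpace I q from η) (show TangentSpace I q from η) := by
  haveI : Fact (1 ≤ n) := ⟨le_trans (by exact_mod_cast le_top) hn⟩
  haveI := contMDiffCovariantDerivative_leviCivita_infty g hn
  set cov := g.leviCivita with hcov
  set ex : E → M := fun u ↦ expMap cov q (show TangentSpace I q from u) with hex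
  set 𝓔 : Set E := {u : E | (show TangentSpace I q from u) ∈ expDomain cov q} with h𝓔
  have h𝓔o : IsOpen 𝓔 := isOpen_expDomain (cov := cov) (k := (⊤ : ℕ∞)) le_top q
  have h0𝓔 : (0 : E) ∈ 𝓔 := zero_mem_expDomain (cov := cov) q
  have hexs : ContMDiffOn 𝓘(ℝ, E) I ((⊤ : ℕ∞) : ℕ∞ω) ex 𝓔 :=
    contMDiffOn_expMap (cov := cov) (k := (⊤ : ℕ∞)) le_top q
  -- the quadratic form of `g` on `TM`, composed with the tangent map of `exp_q`
  set Q : TangentBundle I M → ℝ := fun p ↦ g.val p.proj p.2 p.2 with hQ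
  have hQc : Continuous Q := g.continuous_val_tangentBundle
  set F : E × E → ℝ := fun z ↦ Q (tangentMap 𝓘(ℝ, E) I ex ⟨z.1, z.2⟩) with hF
  have hFc : ∀ η : E, ContinuousAt F ((0 : E), η) := by
    intro η
    -- continuity of the tangent map of `ex` at `⟨0, η⟩`
    have hTW : ContMDiffOn 𝓘(ℝ, E).tangent I.tangent 0 (tangentMapWithin 𝓘(ℝ, E) I ex 𝓔)
        (TotalSpace.proj ⁻¹' 𝓔) :=
      hexs.contMDiffOn_tangentMapWithin (by exact_mod_cast le_top) h𝓔o.uniqueMDiffOn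
    have hpre : (TotalSpace.proj ⁻¹' 𝓔 : Set (TangentBundle 𝓘(ℝ, E) E)) ∈
        𝓝 (⟨(0 : E), η⟩ : TangentBundle 𝓘(ℝ, E) E) :=
      (h𝓔o.preimage (FiberBundle.continuous_proj E (TangentSpace 𝓘(ℝ, E)))).mem_nhds h0𝓔
    have hcW : ContinuousAt (tangentMapWithin 𝓘(ℝ, E) I ex 𝓔) (⟨(0 : E), η⟩ : TangentBundle 𝓘(ℝ, E) E) :=
      (hTW.contMDiffAt hpre).continuousAt
    have heqev : tangentMapWithin 𝓘(ℝ, E) I ex 𝓔 =ᶠ[𝓝 (⟨(0 : E), η⟩ : TangentBundle 𝓘(ℝ, E) E)]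
        tangentMap 𝓘(ℝ, E) I ex := by
      filter_upwards [hpre] with P hP
      exact tangentMapWithin_eq_tangentMap (h𝓔o.uniqueMDiffOn _ hP)
        ((hexs.contMDiffAt (h𝓔o.mem_nhds hP)).mdifferentiableAt (by simp))
    have h2 : ContinuousAt (tangentMap 𝓘(ℝ, E) I ex) (⟨(0 : E), η⟩ : TangentBundle 𝓘(ℝ, E) E) :=
      hcW.congr heqev
    have h3 : ContinuousAt (fun z : E × E ↦ (⟨z.1, z.2⟩ : TangentBundle 𝓘(ℝ, E) E)) ((0 : E), η) :=
      (tangentBundleModelSpaceHomeomorph 𝓘(ℝ, E)).symm.continuous.continuousAt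
    exact ContinuousAt.comp (f := fun z : E × E ↦ (⟨z.1, z.2⟩ : TangentBundle 𝓘(ℝ, E) E))
      (g := fun P ↦ Q (tangentMap 𝓘(ℝ, E) I ex P)) (hQc.continuousAt.comp h2) h3
  -- `F (0, η) = g_q(η, η)`
  have hF0 : ∀ η : E, F ((0 : E), η) = g.val q (show TangentSpace I q from η) (show TangentSpace I q from η) := by
    intro η
    have h1 : mfderiv 𝓘(ℝ, E) I ex 0 η = η := mfderiv_expMap_zero_apply (cov := cov) (k := (⊤ : ℕ∞)) le_top q η
    show g.val (ex 0) (mfderiv 𝓘(ℝ, E) I ex 0 η) (mfderiv 𝓘(ℝ, E) I ex 0 η) = _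
    rw [h1]
    have h0 : ex 0 = q := expMap_zero (cov := cov) q
    rw [h0]
  -- on the compact unit sphere, `F (u, η) < (1 + κ)²` for `u` near `0`
  set K : Set E := {η : E | g.val q (show TangentSpace I q from η) (show TangentSpace I q from η) = 1}
    with hK
  have hKc : IsCompact K := isCompact_setOf_val_eq_one g hg q
  have hκ2 : (1 : ℝ) < (1 + κ) ^ 2 := by nlinarith
  have hev : ∀ η ∈ K, ∀ᶠ z : E × E in 𝓝 ((0 : E), η), F (z.1, z.2) < (1 + κ) ^ 2 := by
    intro η hη
    have h : F ((0 : E), η) < (1 + κ) ^ 2 := by rw [hF0 η, hη]; exact hκ2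
    exact (hFc η).eventually_lt continuousAt_const h
  have hmain := hKc.eventually_forall_of_forall_eventually
    (P := fun u η ↦ F (u, η) < (1 + κ) ^ 2) hev
  filter_upwards [hmain] with u hu η
  -- homogeneity
  by_cases hη : η = 0
  · subst hη
    have h0 : F (u, 0) = 0 := by
      show g.val (ex u) (mfderiv 𝓘(ℝ, E) I ex u (0 : TangentSpace 𝓘(ℝ, E) u))
        (mfderiv 𝓘(ℝ, E) I ex u (0 : TangentSpace 𝓘(ℝ, E) u)) = 0
      rw [map_zero, map_zero]
    have h1 : g.val q (show TangentSpace I q from (0 : E)) (show TangentSpace I q from (0 : E)) = 0 := by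
      show g.val q (0 : TangentSpace I q) (0 : TangentSpace I q) = 0
      rw [map_zero]
    show F (u, 0) ≤ (1 + κ) ^ 2 *
      g.val q (show TangentSpace I q from (0 : E)) (show TangentSpace I q from (0 : E))
    rw [h0, h1, mul_zero]
  set G : ℝ := g.val q (show TangentSpace I q from η) (show TangentSpace I q from η) with hG
  have hGpos : 0 < G := hg q η hη
  set r : ℝ := Real.sqrt G with hr
  have hrpos : 0 < r := Real.sqrt_pos.2 hGpos
  have hrr : r * r = G := Real.mul_self_sqrt hGpos.le
  have hunit : r⁻¹ • η ∈ K := by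
    show g.val q (r⁻¹ • (show TangentSpace I q from η)) (r⁻¹ • (show TangentSpace I q from η)) = 1
    simp only [map_smul, smul_apply, smul_eq_mul]
    rw [show g.val q η η = G from rfl, ← hrr]
    field_simp
  have h1 := hu (r⁻¹ • η) hunit
  -- `F (u, r⁻¹ η) = r⁻² F (u, η)`
  have hscale : F (u, r⁻¹ • η) = r⁻¹ * r⁻¹ * F (u, η) := by
    show g.val (ex u) (mfderiv 𝓘(ℝ, E) I ex u (r⁻¹ • (show TangentSpace 𝓘(ℝ, E) u from η)))
        (mfderiv 𝓘(ℝ, E) I ex u (r⁻¹ • (show TangentSpace 𝓘(ℝ, E) u from η))) =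
      r⁻¹ * r⁻¹ * g.val (ex u) (mfderiv 𝓘(ℝ, E) I ex u η) (mfderiv 𝓘(ℝ, E) I ex u η)
    simp only [map_smul, smul_apply, smul_eq_mul]
    ring
  rw [hscale] at h1
  have h2 : F (u, η) ≤ (1 + κ) ^ 2 * G := by
    have h3 : r⁻¹ * r⁻¹ * F (u, η) * G < (1 + κ) ^ 2 * G := mul_lt_mul_of_pos_right h1 hGpos
    have h4 : r⁻¹ * r⁻¹ * F (u, η) * G = F (u, η) := by
      rw [← hrr]
      field_simp
    linarith
  exact h2

/-! ### Corner cutting -/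

/-- **Corner cutting.** For a smooth Riemannian metric, `q ∈ M` and `g_q`-unit vectors
`a, b ∈ T_qM` with `a + b ≠ 0`, for all sufficiently small `δ > 0`,
`d(exp_q(δa), exp_q(δb)) < 2δ`: the image under `exp_q` of the chord `τ ↦ δ((1-τ)a + τb)` is a
`C¹` curve between these points of length `≤ (1 + κ) δ |b - a|_{g_q}`
(`eventually_val_mfderiv_expMap_le`), and `|b - a|_{g_q} < 2` unless `b = -a`. This is the
estimate that makes a broken geodesic non-minimizing (Lee 2018, proof of Prop. 10.32 (a): the
broken curve "is not smooth at `t = b`, contradicting the fact that minimizing curves are smooth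
geodesics"; here replaced by an explicit shortcut). [cite: LeeRiemannianManifolds2018, Prop. 10.32 (a) (proof)] -/
theorem edist_expMap_smul_lt (hn : (∞ : ℕ∞ω) ≤ n) (hg : g.IsRiemannian) (q : M)
    {a b : TangentSpace I q} (ha : g.val q a a = 1) (hb : g.val q b b = 1) (hab : a + b ≠ 0) :
    ∀ᶠ δ : ℝ in 𝓝[>] 0, g.edist hg (expMap g.leviCivita q (δ • a)) (expMap g.leviCivita q (δ • b))
      < ENNReal.ofReal (2 * δ) := by
  haveI : Fact (1 ≤ n) := ⟨le_trans (by exact_mod_cast le_top) hn⟩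
  haveI := contMDiffCovariantDerivative_leviCivita_infty g hn
  set cov := g.leviCivita with hcov
  set ex : E → M := fun u ↦ expMap cov q (show TangentSpace I q from u) with hex
  set 𝓔 : Set E := {u : E | (show TangentSpace I q from u) ∈ expDomain cov q} with h𝓔
  have h𝓔o : IsOpen 𝓔 := isOpen_expDomain (cov := cov) (k := (⊤ : ℕ∞)) le_top q
  have h0𝓔 : (0 : E) ∈ 𝓔 := zero_mem_expDomain (cov := cov) q
  have hexs : ContMDiffOn 𝓘(ℝ, E) I ((⊤ : ℕ∞) : ℕ∞ω) ex 𝓔 :=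
    contMDiffOn_expMap (cov := cov) (k := (⊤ : ℕ∞)) le_top q
  -- the defect of the corner: `m = |b - a| < 2`
  set m : ℝ := Real.sqrt (g.val q (b - a) (b - a)) with hm
  have hab' : -1 < g.val q a b := by
    have hpos : 0 < g.val q (a + b) (a + b) := hg q (a + b) hab
    have hexp : g.val q (a + b) (a + b) = 2 + 2 * g.val q a b := by
      simp only [map_add, add_apply]
      rw [ha, hb, g.symm q b a]
      ring
    linarith
  have hm2 : g.val q (b - a) (b - a) = 2 - 2 * g.val q a b := by
    simp only [map_sub, sub_apply]
    rw [ha, hb, g.symm q b a]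
    ring
  have hm0 : 0 ≤ m := Real.sqrt_nonneg _
  have hmlt : m < 2 := by
    rw [hm, Real.sqrt_lt' two_pos, hm2]
    have h4 : (2 : ℝ) ^ 2 = 4 := by norm_num
    linarith
  have hnn : 0 ≤ g.val q (b - a) (b - a) := by
    by_cases h0 : b - a = 0
    · rw [h0]; simp
    · exact (hg q _ h0).le
  have hmsq : m * m = g.val q (b - a) (b - a) := Real.mul_self_sqrt hnn
  -- the slack `κ`
  set κ : ℝ := (2 - m) / 4 with hκ
  have hκpos : 0 < κ := by rw [hκ]; linarith
  have hκm : (1 + κ) * m < 2 := by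
    rw [hκ]
    nlinarith
  -- the good ball around `0`
  obtain ⟨r, hr, hball⟩ : ∃ r > 0, ∀ u : E, ‖u‖ < r → u ∈ 𝓔 ∧ ∀ η : E,
      g.val (ex u) (mfderiv 𝓘(ℝ, E) I ex u η) (mfderiv 𝓘(ℝ, E) I ex u η) ≤
        (1 + κ) ^ 2 * g.val q (show TangentSpace I q from η) (show TangentSpace I q from η) := by
    have h := Filter.Eventually.and (show ∀ᶠ u : E in 𝓝 0, u ∈ 𝓔 from h𝓔o.mem_nhds h0𝓔)
      (eventually_val_mfderiv_expMap_le g hn hg q hκpos)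
    obtain ⟨r, hr, hrb⟩ := Metric.eventually_nhds_iff.1 h
    exact ⟨r, hr, fun u hu ↦ hrb (by simpa using hu)⟩
  -- small `δ`: the chord stays in the ball
  have hδ : ∀ᶠ δ : ℝ in 𝓝[>] 0, 0 < δ ∧ δ * (‖(show E from a)‖ + ‖(show E from b)‖) < r := by
    have h1 : ∀ᶠ δ : ℝ in 𝓝[>] 0, 0 < δ := self_mem_nhdsWithin
    have h2 : ∀ᶠ δ : ℝ in 𝓝 (0 : ℝ), δ * (‖(show E from a)‖ + ‖(show E from b)‖) < r := by
      have hc : Continuous fun δ : ℝ ↦ δ * (‖(show E from a)‖ + ‖(show E from b)‖) :=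
        continuous_id.mul continuous_const
      have h := hc.continuousAt (x := 0)
      exact h.eventually_lt continuousAt_const (by simpa using hr)
    exact h1.and (nhdsWithin_le_nhds h2)
  filter_upwards [hδ] with δ hδ'
  obtain ⟨hδpos, hδr⟩ := hδ'
  -- the chord and its image
  set z : ℝ → E := fun τ ↦ δ • (show E from a) + τ • (δ • ((show E from b) - (show E from a))) with hz
  have hz0 : z 0 = δ • (show E from a) := by simp [hz]
  have hz1 : z 1 = δ • (show E from b) := by
    simp only [hz, one_smul, smul_sub]
    abel
  have hzd : ∀ τ, HasMFDerivAt 𝓘(ℝ, ℝ) 𝓘(ℝ, E) z τ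
      (ContinuousLinearMap.toSpanSingleton ℝ ((1 : ℝ) • (δ • ((show E from b) - (show E from a))))) :=
    fun τ ↦ hasMFDerivAt_iff_hasFDerivAt.2
      (((hasDerivAt_id' τ).smul_const _).const_add _).hasFDerivAt
  have hzball : ∀ τ ∈ Icc (0 : ℝ) 1, ‖z τ‖ < r := by
    intro τ hτ
    have h1 : z τ = ((1 - τ) * δ) • (show E from a) + (τ * δ) • (show E from b) := by
      simp only [hz, smul_sub, mul_smul, sub_smul, one_smul]
      rw [smul_comm τ δ (show E from b), smul_comm τ δ (show E from a)]
      abel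
    rw [h1]
    calc ‖((1 - τ) * δ) • (show E from a) + (τ * δ) • (show E from b)‖
        ≤ ‖((1 - τ) * δ) • (show E from a)‖ + ‖(τ * δ) • (show E from b)‖ := norm_add_le _ _
      _ = (1 - τ) * δ * ‖(show E from a)‖ + τ * δ * ‖(show E from b)‖ := by
          rw [norm_smul, norm_smul, Real.norm_of_nonneg (by nlinarith [hτ.1, hτ.2]),
            Real.norm_of_nonneg (by nlinarith [hτ.1, hτ.2])]
      _ ≤ δ * ‖(show E from a)‖ + δ * ‖(show E from b)‖ := by
          gcongr
          · nlinarith [hτ.1, norm_nonneg (show E from a)]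
          · nlinarith [hτ.2, norm_nonneg (show E from b)]
      _ = δ * (‖(show E from a)‖ + ‖(show E from b)‖) := by ring
      _ < r := hδr
  have hz𝓔 : ∀ τ ∈ Icc (0 : ℝ) 1, z τ ∈ 𝓔 := fun τ hτ ↦ (hball _ (hzball τ hτ)).1
  set c : ℝ → M := ex ∘ z with hc
  -- `c` is `C¹` on `[0, 1]`
  have hzs : ContMDiff 𝓘(ℝ, ℝ) 𝓘(ℝ, E) ∞ z :=
    contMDiff_const.add (contMDiff_id.smul contMDiff_const)
  have hcs : ContMDiffOn 𝓘(ℝ, ℝ) I 1 c (Icc 0 1) := by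
    have h1 : ContMDiffOn 𝓘(ℝ, ℝ) I ((⊤ : ℕ∞) : ℕ∞ω) c (Icc 0 1) :=
      hexs.comp (hzs.of_le (by exact_mod_cast le_top)).contMDiffOn fun τ hτ ↦ hz𝓔 τ hτ
    exact h1.of_le (by exact_mod_cast le_top)
  -- pointwise speed bound
  have hspeed : ∀ τ ∈ Icc (0 : ℝ) 1,
      Real.sqrt (g.val (c τ) (mfderiv 𝓘(ℝ, ℝ) I c τ 1) (mfderiv 𝓘(ℝ, ℝ) I c τ 1)) ≤
        (1 + κ) * δ * m := by
    intro τ hτ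
    have hexd : MDifferentiableAt 𝓘(ℝ, E) I ex (z τ) :=
      (hexs.contMDiffAt (h𝓔o.mem_nhds (hz𝓔 τ hτ))).mdifferentiableAt (by simp)
    have hcomp := hexd.hasMFDerivAt.comp τ (hzd τ)
    have h1 : mfderiv 𝓘(ℝ, ℝ) I c τ 1 =
        mfderiv 𝓘(ℝ, E) I ex (z τ) (δ • ((show E from b) - (show E from a))) := by
      rw [hc, hcomp.mfderiv]
      have h2 : (ContinuousLinearMap.toSpanSingleton ℝ
          ((1 : ℝ) • (δ • ((show E from b) - (show E from a))))) (1 : ℝ) =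
            δ • ((show E from b) - (show E from a)) := by simp
      exact congrArg (mfderiv 𝓘(ℝ, E) I ex (z τ)) h2
    rw [h1]
    have h2 := (hball _ (hzball τ hτ)).2 (δ • ((show E from b) - (show E from a)))
    have h3 : g.val q (show TangentSpace I q from (δ • ((show E from b) - (show E from a))))
        (show TangentSpace I q from (δ • ((show E from b) - (show E from a)))) = δ * δ * (m * m) := by
      rw [hmsq]
      show g.val q (δ • (b - a)) (δ • (b - a)) = δ * δ * g.val q (b - a) (b - a)
      simp only [map_smul, smul_apply, smul_eq_mul]
      ring
    rw [h3] at h2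
    have h4 : (1 + κ) ^ 2 * (δ * δ * (m * m)) = ((1 + κ) * δ * m) ^ 2 := by ring
    rw [h4] at h2
    calc Real.sqrt _ ≤ Real.sqrt (((1 + κ) * δ * m) ^ 2) := Real.sqrt_le_sqrt h2
      _ = (1 + κ) * δ * m := Real.sqrt_sq (by positivity)
  -- length bound
  have hlen : g.length hg c 0 1 ≤ ENNReal.ofReal ((1 + κ) * δ * m) := by
    rw [g.length_eq_lintegral hg]
    calc ∫⁻ t in Icc (0 : ℝ) 1, ENNReal.ofReal (Real.sqrt (g.val (c t) (mfderiv 𝓘(ℝ, ℝ) I c t 1)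
          (mfderiv 𝓘(ℝ, ℝ) I c t 1)))
        ≤ ∫⁻ _ in Icc (0 : ℝ) 1, ENNReal.ofReal ((1 + κ) * δ * m) :=
          MeasureTheory.setLIntegral_mono measurable_const fun t ht ↦
            ENNReal.ofReal_le_ofReal (hspeed t ht)
      _ = ENNReal.ofReal ((1 + κ) * δ * m) := by
          rw [MeasureTheory.setLIntegral_const, Real.volume_Icc, sub_zero, ENNReal.ofReal_one,
            mul_one]
  -- conclusion
  have hdist : g.edist hg (c 0) (c 1) ≤ g.length hg c 0 1 := edist_le_length hg zero_le_one hcs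
  have hc0 : c 0 = expMap cov q (δ • a) := by
    show ex (z 0) = _
    rw [hz0]
    rfl
  have hc1 : c 1 = expMap cov q (δ • b) := by
    show ex (z 1) = _
    rw [hz1]
    rfl
  rw [hc0, hc1] at hdist
  refine lt_of_le_of_lt (hdist.trans hlen) ?_
  rw [ENNReal.ofReal_lt_ofReal_iff (by positivity)]
  calc (1 + κ) * δ * m = δ * ((1 + κ) * m) := by ring
    _ < δ * 2 := by gcongr
    _ = 2 * δ := by ring

/-- **Corner cutting, in the form of hypothesis (L2) of
`HopfRinowCompact.exists_isMinimizingUpTo_of_local`**: for `g_y`-unit vectors `u ≠ w` there is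
`s₀ > 0` with `d(exp_y(-s u), exp_y(s w)) < 2s` for `0 < s < s₀` (`edist_expMap_smul_lt` with
`a = -u`, `b = w`). [cite: LeeRiemannianManifolds2018, Prop. 10.32 (a) (proof)] -/
theorem exists_edist_riemannianExpMap_neg_smul_lt (hn : (∞ : ℕ∞ω) ≤ n) (hg : g.IsRiemannian)
    (y : M) (u w : TangentSpace I y) (hu : g.val y u u = 1) (hw : g.val y w w = 1) (huw : u ≠ w) :
    ∃ s₀ : ℝ, 0 < s₀ ∧ ∀ s : ℝ, 0 < s → s < s₀ →
      g.edist hg (riemannianExpMap g y ((-s) • u)) (riemannianExpMap g y (s • w)) <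
        ENNReal.ofReal (2 * s) := by
  have ha : g.val y (-u) (-u) = 1 := by
    simp only [map_neg, neg_apply, neg_neg]
    exact hu
  have hab : -u + w ≠ 0 := by
    intro h
    apply huw
    have h' : w = u := by
      have := eq_neg_of_add_eq_zero_right h
      -- `w = -(-u) = u`
      rw [this, neg_neg]
    exact h'.symm
  have hev := edist_expMap_smul_lt g hn hg y ha hw hab
  rw [eventually_nhdsWithin_iff, Metric.eventually_nhds_iff] at hev
  obtain ⟨ε, hε, hεP⟩ := hev
  refine ⟨ε, hε, fun s hs hsε ↦ ?_⟩
  have h := hεP (by simpa [Real.dist_eq, abs_of_pos hs] using hsε) hs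
  have h1 : s • (-u) = (-s) • u := by rw [smul_neg, neg_smul]
  rw [h1] at h
  exact h

end Literature.Geometry.Riemannian
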